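import Literature.NumberTheory.DiophantineGeometry.TernaryConicRootClasses
import HarnessLib

/-!
# Heath-Brown's conic bound, II: local classes of the model equation

Auxiliary file (theorems only, no definitions) for the proof of
`Literature.NumberTheory.DiophantineGeometry.TernaryConicPointBound` (D. R. Heath-Brown, *The density
of rational points on curves and surfaces*, Ann. of Math. 155 (2002), Corollary 2, key
`Heathbrown2002`), discharged in `TernaryConicPointBoundProofs`.

This file is the LOCAL input at a prime `q` dividing the determinant, in MODEL form. After a change
of coordinates adapted to `q` (file `TernaryConicLocal`), an integral zero of the ternary form
becomes an integral solution `y` of a model equation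
`a y₀² + 2 b y₀ y₁ + d y₁² + m y₂² = 0`, with `b² - a d = q^e D₀`, `q ∤ D₀`, `q^μ ∣ m`.
We attach to `y` a class `cls y₀ y₁ < 2 (μ - e) + 3` and prove
(`TernaryConic.exists_modelCls`) that two solutions in the same class have
`q^{μ - e - [q = 2]} ∣ y₀ z₁ - z₀ y₁`: write `(y₀, y₁) = q^k (u₀, u₁)` with `(u₀, u₁)` not both
divisible by `q` (`reduce_spec`); if `2k ≥ μ - e` the divisibility is trivial (class `0`), otherwise
`q^n ∣ H(u)` with `n = μ - 2k > e` and the binary step `TernaryConic.binary_minor_dvd` of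
`TernaryConicRootClasses` applies to the reduced pairs, the class recording `k`, which reduced
coordinate is a `q`-unit, and the root bit.

## References

* D. R. Heath-Brown, Ann. of Math. 155 (2002), Corollary 2 and §3 [Heathbrown2002]; D. R.
  Heath-Brown, *The density of rational points on cubic surfaces*, Acta Arith. 79 (1997), proof of
  Theorem 2 (the local lattices at the primes of `Δ`).
-/

namespace Literature.NumberTheory.DiophantineGeometry

namespace TernaryConic

/-! ### The model classes -/

/-- The reduced pair: with `k = v_q(gcd(y₀, y₁))` (for `(y₀, y₁) ≠ 0`), `yᵢ = q^k · (yᵢ / q^k)` and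
the two quotients are not both divisible by `q`. [folklore] -/
theorem reduce_spec {q : ℕ} (hq : q.Prime) {y₀ y₁ : ℤ} (hy : y₀ ≠ 0 ∨ y₁ ≠ 0) :
    y₀ = (q : ℤ) ^ padicValNat q (Int.gcd y₀ y₁) * (y₀ / (q : ℤ) ^ padicValNat q (Int.gcd y₀ y₁)) ∧
    y₁ = (q : ℤ) ^ padicValNat q (Int.gcd y₀ y₁) * (y₁ / (q : ℤ) ^ padicValNat q (Int.gcd y₀ y₁)) ∧
    ¬ ((q : ℤ) ∣ y₀ / (q : ℤ) ^ padicValNat q (Int.gcd y₀ y₁) ∧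
       (q : ℤ) ∣ y₁ / (q : ℤ) ^ padicValNat q (Int.gcd y₀ y₁)) := by
  haveI := Fact.mk hq
  set k := padicValNat q (Int.gcd y₀ y₁) with hk
  have hg0 : Int.gcd y₀ y₁ ≠ 0 := by
    rw [Ne, Int.gcd_eq_zero_iff]
    tauto
  have hgk : ((q ^ k : ℕ) : ℤ) ∣ (Int.gcd y₀ y₁ : ℤ) :=
    Int.natCast_dvd_natCast.mpr pow_padicValNat_dvd
  have h0 : (q : ℤ) ^ k ∣ y₀ := by
    exact_mod_cast hgk.trans (Int.gcd_dvd_left y₀ y₁)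
  have h1 : (q : ℤ) ^ k ∣ y₁ := by
    exact_mod_cast hgk.trans (Int.gcd_dvd_right y₀ y₁)
  have e0 : (q : ℤ) ^ k * (y₀ / (q : ℤ) ^ k) = y₀ := Int.mul_ediv_cancel' h0
  have e1 : (q : ℤ) ^ k * (y₁ / (q : ℤ) ^ k) = y₁ := Int.mul_ediv_cancel' h1
  refine ⟨e0.symm, e1.symm, ?_⟩
  rintro ⟨hu0, hu1⟩
  have h0' : ((q ^ (k + 1) : ℕ) : ℤ) ∣ y₀ := by
    have : (q : ℤ) ^ (k + 1) ∣ (q : ℤ) ^ k * (y₀ / (q : ℤ) ^ k) := by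
      rw [pow_succ]
      exact mul_dvd_mul_left _ hu0
    rw [e0] at this
    exact_mod_cast this
  have h1' : ((q ^ (k + 1) : ℕ) : ℤ) ∣ y₁ := by
    have : (q : ℤ) ^ (k + 1) ∣ (q : ℤ) ^ k * (y₁ / (q : ℤ) ^ k) := by
      rw [pow_succ]
      exact mul_dvd_mul_left _ hu1
    rw [e1] at this
    exact_mod_cast this
  exact pow_succ_padicValNat_not_dvd hg0 (Int.dvd_gcd h0' h1')

/-- Scaling the binary form: `H(c u) = c² H(u)`. [folklore] -/
theorem binary_scale (a b d c u₀ u₁ : ℤ) :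
    a * (c * u₀) ^ 2 + 2 * b * (c * u₀) * (c * u₁) + d * (c * u₁) ^ 2
      = c ^ 2 * (a * u₀ ^ 2 + 2 * b * u₀ * u₁ + d * u₁ ^ 2) := by
  ring

/-- `Bool.toNat` is injective. [folklore] -/
theorem bool_eq_of_toNat_eq {u v : Bool} (h : u.toNat = v.toNat) : u = v := by
  cases u <;> cases v <;> simp_all

/-- **The model classes.** For the model equation `a y₀² + 2b y₀y₁ + d y₁² + m y₂² = 0` at a prime
`q`, with `b² - ad = q^e D₀`, `q ∤ D₀`, `q^μ ∣ m`, there is a class function `cls` on pairs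
`(y₀, y₁)` with fewer than `2 (μ - e) + 3` values such that two solutions `y, z` with
`(y₀,y₁), (z₀,z₁) ≠ 0` in the same class satisfy `q^{μ - e - [q=2]} ∣ y₀z₁ - z₀y₁`.
(The class is `0` if `q^{⌈(μ-e)/2⌉} ∣ (y₀, y₁)`, and otherwise `1 + 4k + 2·side + bit` with
`k = v_q(gcd(y₀,y₁))`, `side` recording which reduced coordinate is a `q`-unit and `bit` the root
bit of the completed square, see `TernaryConicRootClasses`.) [folklore] -/
theorem exists_modelCls {q : ℕ} (hq : q.Prime) (a b d m D₀ : ℤ) {e μ : ℕ}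
    (hD : b ^ 2 - a * d = (q : ℤ) ^ e * D₀) (hD₀ : ¬ (q : ℤ) ∣ D₀) (hm : (q : ℤ) ^ μ ∣ m) :
    ∃ cls : ℤ → ℤ → ℕ, (∀ y₀ y₁, cls y₀ y₁ < 2 * (μ - e) + 3) ∧
      ∀ y z : Fin 3 → ℤ, (y 0 ≠ 0 ∨ y 1 ≠ 0) → (z 0 ≠ 0 ∨ z 1 ≠ 0) →
        a * y 0 ^ 2 + 2 * b * y 0 * y 1 + d * y 1 ^ 2 + m * y 2 ^ 2 = 0 →
        a * z 0 ^ 2 + 2 * b * z 0 * z 1 + d * z 1 ^ 2 + m * z 2 ^ 2 = 0 →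
        cls (y 0) (y 1) = cls (z 0) (z 1) →
        (q : ℤ) ^ (μ - e - (if q = 2 then 1 else 0)) ∣ y 0 * z 1 - z 0 * y 1 := by
  have hqZ : Prime (q : ℤ) := Nat.prime_iff_prime_int.mp hq
  -- the root bit
  set bit : ℤ → ℤ → Bool := fun ω u => if q = 2 then decide ((4 : ℤ) ∣ ω - u)
      else decide ((((ω : ZMod q) * ((u : ZMod q))⁻¹).val) ≤ q / 2) with hbit
  have hbit_def : ∀ ω u, bit ω u = if q = 2 then decide ((4 : ℤ) ∣ ω - u)
      else decide ((((ω : ZMod q) * ((u : ZMod q))⁻¹).val) ≤ q / 2) := fun _ _ => rfl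
  -- the class function
  set cls : ℤ → ℤ → ℕ := fun y₀ y₁ =>
    if μ ≤ e + 2 * padicValNat q (Int.gcd y₀ y₁) then 0
    else if ¬ (q : ℤ) ∣ y₁ / (q : ℤ) ^ padicValNat q (Int.gcd y₀ y₁) then
      1 + 4 * padicValNat q (Int.gcd y₀ y₁) +
        (bit ((a * (y₀ / (q : ℤ) ^ padicValNat q (Int.gcd y₀ y₁))
            + b * (y₁ / (q : ℤ) ^ padicValNat q (Int.gcd y₀ y₁))) / (q : ℤ) ^ (e / 2))
          (y₁ / (q : ℤ) ^ padicValNat q (Int.gcd y₀ y₁))).toNat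
    else
      3 + 4 * padicValNat q (Int.gcd y₀ y₁) +
        (bit ((d * (y₁ / (q : ℤ) ^ padicValNat q (Int.gcd y₀ y₁))
            + b * (y₀ / (q : ℤ) ^ padicValNat q (Int.gcd y₀ y₁))) / (q : ℤ) ^ (e / 2))
          (y₀ / (q : ℤ) ^ padicValNat q (Int.gcd y₀ y₁))).toNat with hcls_def
  refine ⟨cls, fun y₀ y₁ => ?_, fun y z hy hz hQy hQz hcls => ?_⟩
  · rw [hcls_def]
    beta_reduce
    have hb1 := Bool.toNat_le (bit ((a * (y₀ / (q : ℤ) ^ padicValNat q (Int.gcd y₀ y₁))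
      + b * (y₁ / (q : ℤ) ^ padicValNat q (Int.gcd y₀ y₁))) / (q : ℤ) ^ (e / 2))
      (y₁ / (q : ℤ) ^ padicValNat q (Int.gcd y₀ y₁)))
    have hb2 := Bool.toNat_le (bit ((d * (y₁ / (q : ℤ) ^ padicValNat q (Int.gcd y₀ y₁))
      + b * (y₀ / (q : ℤ) ^ padicValNat q (Int.gcd y₀ y₁))) / (q : ℤ) ^ (e / 2))
      (y₀ / (q : ℤ) ^ padicValNat q (Int.gcd y₀ y₁)))
    split_ifs <;> omega
  obtain ⟨hy0, hy1, hyu⟩ := reduce_spec hq hy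
  obtain ⟨hz0, hz1, hzu⟩ := reduce_spec hq hz
  rw [hcls_def] at hcls
  beta_reduce at hcls
  set ky := padicValNat q (Int.gcd (y 0) (y 1)) with hky
  set kz := padicValNat q (Int.gcd (z 0) (z 1)) with hkz
  set u₀ := y 0 / (q : ℤ) ^ ky with hu₀
  set u₁ := y 1 / (q : ℤ) ^ ky with hu₁
  set v₀ := z 0 / (q : ℤ) ^ kz with hv₀
  set v₁ := z 1 / (q : ℤ) ^ kz with hv₁
  set ν : ℕ := if q = 2 then 1 else 0 with hν
  -- the binary form values
  have hHy : (q : ℤ) ^ μ ∣ (q : ℤ) ^ (2 * ky) * (a * u₀ ^ 2 + 2 * b * u₀ * u₁ + d * u₁ ^ 2) := by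
    have h1 : a * y 0 ^ 2 + 2 * b * y 0 * y 1 + d * y 1 ^ 2 = -(m * y 2 ^ 2) := by
      linear_combination hQy
    have h2 : (q : ℤ) ^ μ ∣ a * y 0 ^ 2 + 2 * b * y 0 * y 1 + d * y 1 ^ 2 := by
      rw [h1, dvd_neg]; exact hm.mul_right _
    rwa [hy0, hy1, binary_scale, ← pow_mul'] at h2
  have hHz : (q : ℤ) ^ μ ∣ (q : ℤ) ^ (2 * kz) * (a * v₀ ^ 2 + 2 * b * v₀ * v₁ + d * v₁ ^ 2) := by
    have h1 : a * z 0 ^ 2 + 2 * b * z 0 * z 1 + d * z 1 ^ 2 = -(m * z 2 ^ 2) := by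
      linear_combination hQz
    have h2 : (q : ℤ) ^ μ ∣ a * z 0 ^ 2 + 2 * b * z 0 * z 1 + d * z 1 ^ 2 := by
      rw [h1, dvd_neg]; exact hm.mul_right _
    rwa [hz0, hz1, binary_scale, ← pow_mul'] at h2
  -- the minor
  have hminor : y 0 * z 1 - z 0 * y 1 = (q : ℤ) ^ (ky + kz) * (u₀ * v₁ - v₀ * u₁) := by
    rw [hy0, hy1, hz0, hz1, pow_add]; ring
  have hb1 := Bool.toNat_le (bit ((a * u₀ + b * u₁) / (q : ℤ) ^ (e / 2)) u₁)
  have hb2 := Bool.toNat_le (bit ((d * u₁ + b * u₀) / (q : ℤ) ^ (e / 2)) u₀)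
  have hb3 := Bool.toNat_le (bit ((a * v₀ + b * v₁) / (q : ℤ) ^ (e / 2)) v₁)
  have hb4 := Bool.toNat_le (bit ((d * v₁ + b * v₀) / (q : ℤ) ^ (e / 2)) v₀)
  by_cases hBy : μ ≤ e + 2 * ky
  · -- Case B for `y`; then also for `z`
    rw [if_pos hBy] at hcls
    have hBz : μ ≤ e + 2 * kz := by
      by_contra h
      rw [if_neg h] at hcls
      split_ifs at hcls <;> omega
    rw [hminor]
    exact dvd_mul_of_dvd_left (pow_dvd_pow _ (by omega)) _
  · rw [if_neg hBy] at hcls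
    have hBz : ¬ μ ≤ e + 2 * kz := by
      intro h
      rw [if_pos h] at hcls
      split_ifs at hcls <;> omega
    rw [if_neg hBz] at hcls
    -- same `k`
    have hk : ky = kz := by
      split_ifs at hcls <;> omega
    -- `q^n ∣ H(u)`, `q^n ∣ H(v)` with `n = μ - 2k > e`
    obtain ⟨n, hn⟩ : ∃ n, μ = 2 * ky + n := ⟨μ - 2 * ky, by omega⟩
    have hen : e < n := by omega
    have hHu : (q : ℤ) ^ n ∣ a * u₀ ^ 2 + 2 * b * u₀ * u₁ + d * u₁ ^ 2 := by
      rw [hn, pow_add] at hHy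
      exact (mul_dvd_mul_iff_left (pow_ne_zero _ hqZ.ne_zero)).mp hHy
    have hHv : (q : ℤ) ^ n ∣ a * v₀ ^ 2 + 2 * b * v₀ * v₁ + d * v₁ ^ 2 := by
      rw [hk] at hn
      rw [hn, pow_add] at hHz
      exact (mul_dvd_mul_iff_left (pow_ne_zero _ hqZ.ne_zero)).mp hHz
    -- it suffices to bound the reduced minor
    suffices hred : (q : ℤ) ^ (n - e / 2 - ν) ∣ u₀ * v₁ - v₀ * u₁ by
      rw [hminor]
      have hexp : μ - e - ν ≤ (ky + kz) + (n - e / 2 - ν) := by omega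
      exact (pow_dvd_pow _ hexp).trans (by rw [pow_add]; exact mul_dvd_mul_left _ hred)
    by_cases hsy : ¬ (q : ℤ) ∣ u₁
    · rw [if_pos hsy] at hcls
      have hsz : ¬ (q : ℤ) ∣ v₁ := by
        intro h
        rw [if_neg (not_not.mpr h)] at hcls
        omega
      rw [if_pos hsz] at hcls
      have hbitE : bit ((a * u₀ + b * u₁) / (q : ℤ) ^ (e / 2)) u₁
          = bit ((a * v₀ + b * v₁) / (q : ℤ) ^ (e / 2)) v₁ := by
        apply bool_eq_of_toNat_eq
        omega
      exact binary_minor_dvd hq bit hbit_def a b d D₀ hD hD₀ hen hsy hsz hHu hHv hbitE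
    · rw [if_neg hsy] at hcls
      have hsy' : ¬ (q : ℤ) ∣ u₀ := fun h => hyu ⟨h, not_not.mp hsy⟩
      have hsz : ¬ ¬ (q : ℤ) ∣ v₁ := by
        intro h
        rw [if_pos h] at hcls
        omega
      rw [if_neg hsz] at hcls
      have hsz' : ¬ (q : ℤ) ∣ v₀ := fun h => hzu ⟨h, not_not.mp hsz⟩
      have hbitE : bit ((d * u₁ + b * u₀) / (q : ℤ) ^ (e / 2)) u₀
          = bit ((d * v₁ + b * v₀) / (q : ℤ) ^ (e / 2)) v₀ := by
        apply bool_eq_of_toNat_eq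
        omega
      have hD' : b ^ 2 - d * a = (q : ℤ) ^ e * D₀ := by rw [← hD]; ring
      have hHu' : (q : ℤ) ^ n ∣ d * u₁ ^ 2 + 2 * b * u₁ * u₀ + a * u₀ ^ 2 := by
        have : d * u₁ ^ 2 + 2 * b * u₁ * u₀ + a * u₀ ^ 2
            = a * u₀ ^ 2 + 2 * b * u₀ * u₁ + d * u₁ ^ 2 := by ring
        rwa [this]
      have hHv' : (q : ℤ) ^ n ∣ d * v₁ ^ 2 + 2 * b * v₁ * v₀ + a * v₀ ^ 2 := by
        have : d * v₁ ^ 2 + 2 * b * v₁ * v₀ + a * v₀ ^ 2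
            = a * v₀ ^ 2 + 2 * b * v₀ * v₁ + d * v₁ ^ 2 := by ring
        rwa [this]
      have h := binary_minor_dvd hq bit hbit_def d b a D₀ hD' hD₀ hen hsy' hsz' hHu' hHv' hbitE
      have : u₀ * v₁ - v₀ * u₁ = -(u₁ * v₀ - v₁ * u₀) := by ring
      rw [this, dvd_neg]
      exact h

end TernaryConic

end Literature.NumberTheory.DiophantineGeometry
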